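import Literature.MathematicalPhysics.QuantumFieldTheory.Balaban1983to89.Node00.Record12LiveSelectorTorus

/-!
# NODE 00 (YM-PLAN Track A) — ROW P12 AT THE LIVE SELECTOR, HISTORY-GENERIC, IN THE INTEGRABLE CURRENCY: along ANY history `g`, ANY normalisation `E`,
# ANY step weights `w`, the post-𝐑 slots of record at the LIVE SELECTOR OF RECORD do not vanish on its range at every level `k ≤ K`, from the displayed
# step provisos and def-R's INTEGRABLE-form (0.3) provisos alone — the form the successor record `Record13` (`rstep ↦ .ProvisosInt`, histories
# `gOfRecord₁₃`) and every later record instantiate in five lines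

Cell `pub-ymgap`, seat `pub-ymgap-node00-def-K0a` (g3); RECORD13-CLOSABILITY-GATE rows G ∕ P12∕S («at ₁₃ ◐ pen K0a; K0b's ₁₃ P12 twin absorbed»).
[III] = [Balaban1988Convergent], [IV] = [Balaban1989LargeFieldI], [B5] = [Balaban1985UV3].

WHY.  Row P12 (`SlotsNondegenerate` at the K0′ witness) is a THEOREM at Stage 12 by the junction `Record12LiveSelectorTorus` (this seat) ∘ `Record12PresentSlots`
(seat K0b): K0b's §4 proves «live terms exist at every level `k + 1 ≤ K`» for a Stage-9 tuple `θ′` under `Provisos₁₀`, i.e. ALONG THE STAGE-10 HISTORIES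
`gOfRecord₁₀ θ′` and in the SUPPORT-FORM (0.3) currency; its v1.1 §7 re-proves it in def-R's INTEGRABLE currency (`RStepInt`), still keyed on `gOfRecord₁₀`.
Director-ym LINE №125 orders the successor record `Record13` with `rstep ↦ .ProvisosInt` and histories `gOfRecord₁₃ := genSeq β₁₃ g₀` (def-T READY-13), and the
closability gate asks for rows G ∕ P12 at the ₁₃ witness with a pen and an ETA; seat K0b is unseated.  EVERY INPUT OF THE P12 ARGUMENT IS HISTORY-GENERIC —
def-T's `isRT_trhoOfRecord9` ∕ `integrable_piece_trhoOfRecord9` ∕ `rhoOfRecord9_zero` ∕ `rhoOfRecord9_succ`, def-R's `integral_densityOfSlice_rstepSlotOfRecord_of_provisosInt`,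
K0b's `integral_chi_mul_slotsTOfRecord_succ` ∕ `exists_ne_zero_and_fibreIntegral_ne_zero_of_integrable`, this seat's `liveSeq_of_ne_zero` ∕
`slotsOfRecord_ppSelLive_succ_nondegenerate_iff` ∕ `slotsOfRecord_zero_ne_zero` all take `(ν, τ, E, w, ppSel, p, g)` as free arguments — so this file states and
proves the row ONCE for arbitrary `(E, w, g)`: no record, no `θ`, no `Provisos` structure is read.  Its Stage-12 instance (§3) is the already-landed theorem
`Stage12Params.slotsNondegenerate_liveRepin` with `Provisos₁₀` weakened to «step provisos ∧ Int-form R-step provisos at the live selector»; its Stage-13 instance is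
the same five lines over `gOfRecord₁₃` ∕ `EOfRecord₁₃` ∕ `Provisos₁₃.tstep` ∕ `.rstep` once `Node00/Record13.lean` lands (this seat's FILE 8).

WHAT THIS FILE PROVES (theorems only; generic `ν τ E w ppSel p g` unless said).
* §1 MASS CONSERVATION AND LIVE TERMS, INT CURRENCY, ANY SELECTOR: `integral_rhoOfRecord9_succ_eq_of_int` (`∫ρ_{j+1} = ∫ρ_j`), `integral_rhoOfRecord9_eq_zero_of_int`
  (`∫ρ_k = ∫ρ₀`, `k ≤ K`), `integral_rhoOfRecord9_pos_of_int` (`> 0`), `exists_integral_graph_ne_zero_generic_of_int`, ★ `exists_live_slotsTOfRecord_succ_generic_of_int` (at every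
  level `k + 1 ≤ K` some sequence has non-zero 𝐓-image slot AND non-zero own fibre integral at a common configuration) — K0b's §7 with `θ′`, `gOfRecord₁₀`,
  `RStepInt` replaced by free `(E, w, ppSel, g)` and the Int provisos as a displayed hypothesis `hR` of the same text.
* §2 AT THE LIVE SELECTOR OF RECORD `ppSelLiveOfRecord E w` (any `E w p g`): `exists_liveSeq_ppSelLive_of_int` and ★★ **`slotsOfRecord_ppSelLive_ne_zero_of_le_of_int`**
  — every range point of the live selector at every level `k ≤ p.K` has non-zero post-𝐑 slot, from `hT` (step provisos at levels `< K`) and `hR` (Int-form R-step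
  provisos at levels `k + 1 ≤ K`), both READ AT THE LIVE SELECTOR — the text of 12b's ∕ READY-13's `SlotsNondegenerate(₁₃)` at a live re-pin, history-generic.
* §3 THE STAGE-12 INSTANCE: `Stage12Params.slotsNondegenerate_liveRepin_of_int (hT) (hR)`; since `Provisos₁₀` supplies both hypotheses (`Provisos₁₀.tstep`,
  def-R's `RepData.provisosInt_of_provisosSupp` ∕ `Stage9Params.rstepInt_of_provisos₁₀`), the landed `slotsNondegenerate_liveRepin (hP)` is its special case (not
  restated); the Int instance is what seat K0c ∕ def-R feed from (H-U) at the live selector (def-R FILE 18 `RStepProvisosIntAtRecord`).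

HONEST FRAMING.  Finite sums and Bochner bookkeeping over landed faces; the analytic inputs are the DISPLAYED hypotheses `hT`, `hR` (never asserted); nothing of
Bałaban's is claimed; no record's `SlotsNondegenerate` is discharged absolutely; counts unmoved (typed 28∕28 · discharged 5∕28); one finite 𝕋⁴ programme at fixed
`ε` — NOT continuum ∕ OS ∕ mass gap ∕ Clay.  No `sorry`, no `axiom`, no `def`, no `instance`, no `notation`.
-/

noncomputable section

open MeasureTheory ProbabilityTheory
open scoped BigOperators Matrix.Norms.L2Operator

namespace Literature.MathematicalPhysics.QuantumFieldTheory.Balaban1983to89.Node00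

open T4AveragingDisintegration T4Continuum T4FiniteEpsInhabited B14.Eq218Concrete B15RopTotal FlowStep FlowStepRuns
open B15.BasicStep (fibreIntegral)

/-! ## §1. Mass conservation and live terms in the INT currency — any selector, any history -/

section IntGeneric

variable (F : T4Family) (N : ℕ) [NeZero N] (ν : Stage7Numerics) (τ : TowerNumerics)
variable (E : B12.RunParams → ℝ) (w : StepWeightsOfRecord F N ν τ.M) (ppSel : PpSelOfRecord F ν τ.M) (p : B12.RunParams) (g : ℕ → ℝ)

/-- **ONE STEP CONSERVES MASS, INT currency, any history**: `∫ρ_{j+1} = ∫𝐓ρ_j = ∫ρ_j` (`j < K`) from the displayed step provisos at level `j` (def-T's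
`isRT_trhoOfRecord9` at `f ≡ 1`) and def-R's (0.4) under the integrable-form (0.3) provisos at level `j+1` (`integral_densityOfSlice_rstepSlotOfRecord_of_provisosInt`).
[cite: Balaban1989LargeFieldI, (0.4) p.176; Balaban1985UV3, (6) p.257] -/
theorem integral_rhoOfRecord9_succ_eq_of_int (j : ℕ) (hj : j < p.K) (hT : TStepProvisos F N ν τ E w ppSel p g j)
    [DecidableEq (PBond (F.P p.K) (j + 1))]
    (hR : (towerRepOfRecord F N ν τ (slotsTOfRecord F N ν τ E w ppSel) ppSel p g (j + 1)).toRepData.ProvisosInt) :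
    ∫ V, rhoOfRecord9 F N ν τ E w ppSel p g (j + 1) V ∂(fieldMeasure (F.P p.K) (j + 1) (SU N))
      = ∫ U, rhoOfRecord9 F N ν τ E w ppSel p g j U ∂(fieldMeasure (F.P p.K) j (SU N)) := by
  have h1 : ∫ V, rhoOfRecord9 F N ν τ E w ppSel p g (j + 1) V ∂(fieldMeasure (F.P p.K) (j + 1) (SU N))
      = ∫ V, trhoOfRecord9 F N ν τ E w ppSel p g j V ∂(fieldMeasure (F.P p.K) (j + 1) (SU N)) := by
    rw [rhoOfRecord9_succ]
    exact integral_densityOfSlice_rstepSlotOfRecord_of_provisosInt F N ν τ _ ppSel p _ (j + 1) hR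
  rw [h1]
  exact T4Spectator.integral_eq_of_isRT (isRT_trhoOfRecord9 F N ν τ E w ppSel p _ j hj hT)

/-- **`∫ρ_k = ∫ρ₀` for `k ≤ K`, INT currency, any history** (induction on the step). [cite: Balaban1985UV3, (6) p.257] -/
theorem integral_rhoOfRecord9_eq_zero_of_int (hT : ∀ j, j < p.K → TStepProvisos F N ν τ E w ppSel p g j)
    (hR : ∀ (j : ℕ) [DecidableEq (PBond (F.P p.K) (j + 1))], j < p.K →
      (towerRepOfRecord F N ν τ (slotsTOfRecord F N ν τ E w ppSel) ppSel p g (j + 1)).toRepData.ProvisosInt) :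
    ∀ k, k ≤ p.K →
      ∫ V, rhoOfRecord9 F N ν τ E w ppSel p g k V ∂(fieldMeasure (F.P p.K) k (SU N))
        = ∫ U, rhoOfRecord9 F N ν τ E w ppSel p g 0 U ∂(fieldMeasure (F.P p.K) 0 (SU N))
  | 0, _ => rfl
  | k + 1, hk =>
    (integral_rhoOfRecord9_succ_eq_of_int F N ν τ E w ppSel p g k (Nat.lt_of_succ_le hk) (hT k (Nat.lt_of_succ_le hk))
        (hR k (Nat.lt_of_succ_le hk))).trans
      (integral_rhoOfRecord9_eq_zero_of_int hT hR k (Nat.le_of_succ_le hk))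

/-- **THE TOTAL MASS IS POSITIVE at every level `k ≤ K`, INT currency, any history**: `∫ρ_k = ∫ρ₀ > 0` (`ρ₀` positive, bounded, measurable on a probability space).
[cite: Balaban1985UV3, (6) p.257; Balaban1988Convergent, Thm 1 p.262] -/
theorem integral_rhoOfRecord9_pos_of_int (hT : ∀ j, j < p.K → TStepProvisos F N ν τ E w ppSel p g j)
    (hR : ∀ (j : ℕ) [DecidableEq (PBond (F.P p.K) (j + 1))], j < p.K →
      (towerRepOfRecord F N ν τ (slotsTOfRecord F N ν τ E w ppSel) ppSel p g (j + 1)).toRepData.ProvisosInt)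
    (k : ℕ) (hk : k ≤ p.K) :
    0 < ∫ U, rhoOfRecord9 F N ν τ E w ppSel p g k U ∂(fieldMeasure (F.P p.K) k (SU N)) := by
  rw [integral_rhoOfRecord9_eq_zero_of_int F N ν τ E w ppSel p g hT hR k hk, rhoOfRecord9_zero]
  haveI : IsProbabilityMeasure (fieldMeasure (F.P p.K) 0 (SU N)) := Missing.isProbabilityMeasure_fieldMeasure (F.P p.K) 0
  have hpos : ∀ U, 0 < rhoZeroOfRecord F N p.K (g 0) (E p) U := fun U => rhoZeroOfRecord_pos F N p.K (g 0) (E p) U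
  have hI : Integrable (rhoZeroOfRecord F N p.K (g 0) (E p)) (fieldMeasure (F.P p.K) 0 (SU N)) :=
    (integrable_const (Real.exp (-(E p)))).mono' (measurable_rhoZeroOfRecord F N p.K (g 0) (E p)).aestronglyMeasurable
      (Filter.Eventually.of_forall fun U => by
        rw [Real.norm_eq_abs, abs_of_pos (hpos U)]
        exact rhoZeroOfRecord_le F N p.K (g 0) (E p) U)
  rw [integral_pos_iff_support_of_nonneg (fun U => (hpos U).le) hI]
  have hsupp : Function.support (rhoZeroOfRecord F N p.K (g 0) (E p)) = Set.univ := Set.eq_univ_of_forall fun U => (hpos U).ne'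
  rw [hsupp, measure_univ]
  exact one_pos

/-- **AT EVERY LEVEL `k+1 ≤ K` SOME NEW SEQUENCE HAS A NON-ZERO GRAPH INTEGRAL, INT currency, any history** (their sum is `∫𝐓ρ_k = ∫ρ_k > 0`).
[cite: Balaban1988Convergent, (3.22) p.269, (2.17)–(2.18) p.257, (3.1) p.264] -/
theorem exists_integral_graph_ne_zero_generic_of_int (hT : ∀ j, j < p.K → TStepProvisos F N ν τ E w ppSel p g j)
    (hR : ∀ (j : ℕ) [DecidableEq (PBond (F.P p.K) (j + 1))], j < p.K →
      (towerRepOfRecord F N ν τ (slotsTOfRecord F N ν τ E w ppSel) ppSel p g (j + 1)).toRepData.ProvisosInt)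
    (k : ℕ) (hk : k < p.K) :
    ∃ s' : SeqOfRecord F ν τ.M g p.K (k + 1),
      ∫ U, (chiSeqOfRecord F N ν τ.M g p.K k s'.init U * slotsOfRecord F N ν τ E w ppSel p g k s'.init U) *
          (w p g k s' U ((avOfRecord F N p.K k).avg U) * chiSeqOfRecord F N ν τ.M g p.K (k + 1) s' ((avOfRecord F N p.K k).avg U))
        ∂(fieldMeasure (F.P p.K) k (SU N)) ≠ 0 := by
  classical
  by_contra hnone
  push Not at hnone
  have hTk := hT k hk
  have hsum : ∑ s' : SeqOfRecord F ν τ.M g p.K (k + 1),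
      ∫ U, (chiSeqOfRecord F N ν τ.M g p.K k s'.init U * slotsOfRecord F N ν τ E w ppSel p g k s'.init U) *
          (w p g k s' U ((avOfRecord F N p.K k).avg U) * chiSeqOfRecord F N ν τ.M g p.K (k + 1) s' ((avOfRecord F N p.K k).avg U))
        ∂(fieldMeasure (F.P p.K) k (SU N))
      = ∫ U, rhoOfRecord9 F N ν τ E w ppSel p g k U ∂(fieldMeasure (F.P p.K) k (SU N)) := by
    calc ∑ s' : SeqOfRecord F ν τ.M g p.K (k + 1),
          ∫ U, (chiSeqOfRecord F N ν τ.M g p.K k s'.init U * slotsOfRecord F N ν τ E w ppSel p g k s'.init U) *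
              (w p g k s' U ((avOfRecord F N p.K k).avg U) * chiSeqOfRecord F N ν τ.M g p.K (k + 1) s' ((avOfRecord F N p.K k).avg U))
            ∂(fieldMeasure (F.P p.K) k (SU N))
        = ∑ s' : SeqOfRecord F ν τ.M g p.K (k + 1),
            ∫ V', chiSeqOfRecord F N ν τ.M g p.K (k + 1) s' V' * slotsTOfRecord F N ν τ E w ppSel p g (k + 1) s' V'
              ∂(fieldMeasure (F.P p.K) (k + 1) (SU N)) :=
          Finset.sum_congr rfl fun s' _ => (integral_chi_mul_slotsTOfRecord_succ F N ν τ E w ppSel p g k hk hTk s').symm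
      _ = ∫ V', ∑ s' : SeqOfRecord F ν τ.M g p.K (k + 1),
            chiSeqOfRecord F N ν τ.M g p.K (k + 1) s' V' * slotsTOfRecord F N ν τ E w ppSel p g (k + 1) s' V'
              ∂(fieldMeasure (F.P p.K) (k + 1) (SU N)) :=
          (integral_finsetSum _ fun s' _ => integrable_piece_trhoOfRecord9 F N ν τ E w ppSel p g k hk hTk s').symm
      _ = ∫ V', trhoOfRecord9 F N ν τ E w ppSel p g k V' ∂(fieldMeasure (F.P p.K) (k + 1) (SU N)) := rfl
      _ = ∫ U, rhoOfRecord9 F N ν τ E w ppSel p g k U ∂(fieldMeasure (F.P p.K) k (SU N)) :=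
          T4Spectator.integral_eq_of_isRT (isRT_trhoOfRecord9 F N ν τ E w ppSel p _ k hk hTk)
  rw [Finset.sum_eq_zero fun s' _ => hnone s'] at hsum
  exact (ne_of_gt (integral_rhoOfRecord9_pos_of_int F N ν τ E w ppSel p g hT hR k hk.le)) hsum.symm

/-- **★ LIVE TERMS EXIST AT EVERY LEVEL `k+1 ≤ K`, INT currency, ANY SELECTOR, ANY HISTORY**: from the displayed step provisos at every level `j < K` and def-R's
Int-form (0.3) provisos at every level `j+1 ≤ K`, there are `s`, `V` with `slotT_{k+1}(s)(V) ≠ 0 ∧ ∫dV⌈_{Z′(s)} χ_{k+1}(s)·slotT_{k+1}(s) (V) ≠ 0` — a live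
GRAPH term exists (mass conservation), its χ-weighted 𝐓-image slot is non-null (K0b §1), and a non-null integrable a.e.-non-negative piece is live somewhere
(K0b §7).  The instance binder `iP` of the fibre integral is the consumer's (def-R TS-8).
[cite: Balaban1988Convergent, (3.22) p.269, (3.1) p.264, (3.24)–(3.25) p.270; Balaban1989LargeFieldI, (0.3)–(0.4) p.176] -/
theorem exists_live_slotsTOfRecord_succ_generic_of_int (hT : ∀ j, j < p.K → TStepProvisos F N ν τ E w ppSel p g j)
    (hR : ∀ (j : ℕ) [DecidableEq (PBond (F.P p.K) (j + 1))], j < p.K →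
      (towerRepOfRecord F N ν τ (slotsTOfRecord F N ν τ E w ppSel) ppSel p g (j + 1)).toRepData.ProvisosInt)
    (k : ℕ) (hk : k < p.K) (iP : DecidableEq (PBond (F.P p.K) (k + 1))) :
    ∃ (s : SeqOfRecord F ν τ.M g p.K (k + 1)) (V : GaugeField (F.P p.K) (k + 1) (SU N)),
      slotsTOfRecord F N ν τ E w ppSel p g (k + 1) s V ≠ 0 ∧
        @fibreIntegral (F.P p.K) (k + 1) (SU N) _ _ _ iP (fibOfSeq F ν τ p g (k + 1) s)
          (fun U => chiSeqOfRecord F N ν τ.M g p.K (k + 1) s U * slotsTOfRecord F N ν τ E w ppSel p g (k + 1) s U) V ≠ 0 := by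
  obtain ⟨s', hne⟩ := exists_integral_graph_ne_zero_generic_of_int F N ν τ E w ppSel p g hT hR k hk
  have hI : ∫ V', chiSeqOfRecord F N ν τ.M g p.K (k + 1) s' V' * slotsTOfRecord F N ν τ E w ppSel p g (k + 1) s' V'
      ∂(fieldMeasure (F.P p.K) (k + 1) (SU N)) ≠ 0 := by
    rwa [integral_chi_mul_slotsTOfRecord_succ F N ν τ E w ppSel p _ k hk (hT k hk) s']
  obtain ⟨hint, h0, -⟩ := @hR k iP hk
  obtain ⟨V, htV, hFV⟩ := exists_ne_zero_and_fibreIntegral_ne_zero_of_integrable (hD := iP)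
    (fibOfSeq F ν τ p g (k + 1) s') (hint s') (h0 s') hI
  exact ⟨s', V, (mul_ne_zero_iff.1 htV).2, hFV⟩

end IntGeneric

/-! ## §2. At the LIVE SELECTOR OF RECORD `ppSelLiveOfRecord E w`, any `E`, `w`, `g`: live sequences and non-vanishing range slots up to the torus -/

section LiveGeneric

variable (F : T4Family) (N : ℕ) [NeZero N] (ν : Stage7Numerics) (τ : TowerNumerics)
variable (E : B12.RunParams → ℝ) (w : StepWeightsOfRecord F N ν τ.M) (p : B12.RunParams) (g : ℕ → ℝ)

/-- **LIVE SEQUENCES EXIST AT EVERY LEVEL `k + 1 ≤ K` AT THE LIVE SELECTOR, INT currency, any history** — §1 at `ppSel := ppSelLiveOfRecord E w` through the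
bridge `liveSeq_of_ne_zero` (`Record12LiveSelectorTorus` §1). [cite: Balaban1988Convergent, (3.22) p.269, (3.24)–(3.25) p.270; Balaban1989LargeFieldI, (0.3)–(0.4) p.176] -/
theorem exists_liveSeq_ppSelLive_of_int
    (hT : ∀ j, j < p.K → TStepProvisos F N ν τ E w (ppSelLiveOfRecord F N ν τ E w) p g j)
    (hR : ∀ (j : ℕ) [DecidableEq (PBond (F.P p.K) (j + 1))], j < p.K →
      (towerRepOfRecord F N ν τ (slotsTOfRecord F N ν τ E w (ppSelLiveOfRecord F N ν τ E w)) (ppSelLiveOfRecord F N ν τ E w) p g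
        (j + 1)).toRepData.ProvisosInt)
    (k : ℕ) (hk : k < p.K) :
    ∃ s, LiveSeq F N ν τ p g (k + 1) (slotsTOfRecord F N ν τ E w (ppSelLiveOfRecord F N ν τ E w) p g (k + 1)) s := by
  classical
  obtain ⟨s, V, hT', hI⟩ := exists_live_slotsTOfRecord_succ_generic_of_int F N ν τ E w (ppSelLiveOfRecord F N ν τ E w) p g hT hR k hk inferInstance
  exact ⟨s, liveSeq_of_ne_zero F N _ hT' hI⟩

/-- **★★ ROW P12 AT THE LIVE SELECTOR, HISTORY-GENERIC, INT currency: every range point of the live selector of record has NON-ZERO post-𝐑 slot at every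
level `k ≤ p.K`** — level `0`: `ρ₀ > 0`; level `k + 1 ≤ K`: a range point of the live selector is a live fixed point, and live points exist by
`exists_liveSeq_ppSelLive_of_int`.  This is the text of 12b's `SlotsNondegenerate` ∕ READY-13's `SlotsNondegenerate₁₃` at a live re-pin, with the history
`g`, the normalisation `E` and the weights `w` FREE: every record instantiates it at its own `gOfRecordₙ`, `EOfRecordₙ`, `wOfRecord₉`.
[cite: Balaban1988Convergent, (3.22) p.269, (3.24) p.270; Balaban1989LargeFieldI, (0.3) p.176] -/
theorem slotsOfRecord_ppSelLive_ne_zero_of_le_of_int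
    (hT : ∀ j, j < p.K → TStepProvisos F N ν τ E w (ppSelLiveOfRecord F N ν τ E w) p g j)
    (hR : ∀ (j : ℕ) [DecidableEq (PBond (F.P p.K) (j + 1))], j < p.K →
      (towerRepOfRecord F N ν τ (slotsTOfRecord F N ν τ E w (ppSelLiveOfRecord F N ν τ E w)) (ppSelLiveOfRecord F N ν τ E w) p g
        (j + 1)).toRepData.ProvisosInt)
    (k : ℕ) (hk : k ≤ p.K) (s : SeqOfRecord F ν τ.M g p.K k) (hs : s ∈ Set.range (ppSelLiveOfRecord F N ν τ E w p g k)) :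
    slotsOfRecord F N ν τ E w (ppSelLiveOfRecord F N ν τ E w) p g k s ≠ 0 := by
  revert s
  cases k with
  | zero => exact fun s _ => slotsOfRecord_zero_ne_zero F N ν τ _ _ _ p _ s
  | succ k =>
    exact (slotsOfRecord_ppSelLive_succ_nondegenerate_iff F N ν τ _ _ p _ k).mpr
      (fun _ => exists_liveSeq_ppSelLive_of_int F N ν τ E w p g hT hR k (Nat.lt_of_succ_le hk))

end LiveGeneric

/-! ## §3. The Stage-12 instance: `SlotsNondegenerate` at the live re-pin of a Stage-12 parameter from the step provisos and the Int-form R-step provisos there -/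

section Stage12

variable (F : T4Family) (N : ℕ) [NeZero N] (θ : Stage12Params F N)

/-- **`SlotsNondegenerate` AT THE LIVE RE-PIN `θ.liveRepin`, INT currency**: from the displayed step provisos at every level `j < K` and def-R's Int-form (0.3)
provisos at every level `j + 1 ≤ K`, both READ AT THE LIVE SELECTOR along the Stage-10 histories — §2 at `(ν, τ, E, w, g) := (θ.ν, θ.τ9, EOfRecord₁₀ θ′, wOfRecord₉ θ′,
gOfRecord₁₀ θ′ p)`.  (`Provisos₁₀` of the re-pinned tuple supplies both — `Provisos₁₀.tstep` and def-R's `RepData.provisosInt_of_provisosSupp` — which is the landed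
`Stage12Params.slotsNondegenerate_liveRepin`; this Int form is what (H-U) feeds through def-R's `RStepProvisosIntAtRecord`.)
[cite: Balaban1988Convergent, (3.22) p.269, (3.24) p.270; Balaban1989LargeFieldI, (0.3)–(0.4) p.176] -/
theorem Stage12Params.slotsNondegenerate_liveRepin_of_int
    (hT : ∀ (p : B12.RunParams) (j : ℕ), j < p.K →
      TStepProvisos F N θ.ν θ.τ9 (EOfRecord₁₀ F N θ.toStage9Params) (wOfRecord₉ F N θ.toStage9Params) (θ.liveRepin F N).ppSel p
        (gOfRecord₁₀ F N θ.toStage9Params p) j)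
    (hR : ∀ (p : B12.RunParams) (j : ℕ) [DecidableEq (PBond (F.P p.K) (j + 1))], j < p.K →
      (towerRepOfRecord F N θ.ν θ.τ9
        (slotsTOfRecord F N θ.ν θ.τ9 (EOfRecord₁₀ F N θ.toStage9Params) (wOfRecord₉ F N θ.toStage9Params) (θ.liveRepin F N).ppSel)
        (θ.liveRepin F N).ppSel p (gOfRecord₁₀ F N θ.toStage9Params p) (j + 1)).toRepData.ProvisosInt) :
    (θ.liveRepin F N).SlotsNondegenerate :=
  fun p k s hk hs => slotsOfRecord_ppSelLive_ne_zero_of_le_of_int F N θ.ν θ.τ9 _ _ p _ (hT p) (fun j _ hj => hR p j hj) k hk s hs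

end Stage12

end Literature.MathematicalPhysics.QuantumFieldTheory.Balaban1983to89.Node00

end
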